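import Literature.AlgebraicGeometry.AbelianSchemes.TorsionSectionPairingBaseChange
import Literature.AlgebraicGeometry.AbelianSchemes.TorsionSectionPairing
import Literature.AlgebraicGeometry.AbelianSchemes.TorsionSectionPointDatum
import HarnessLib

/-!
# The Weil unit `e_n(x, ŷ) ∈ Γ(T, 𝒪_T)` of an `n`-torsion section `x` of `A_T` and an `n`-torsion `T`-point `ŷ` of `Â`, and its base change
# ([Mumford AV] §20 pp. 183–185; the points of the scheme-theoretic Weil pairing `A[n] × Â[n] → μ_n`)

Topic `Literature/AlgebraicGeometry/AbelianSchemes`; namespaces `Literature.AlgebraicGeometry.AbelianSchemes.AbelianSchemeOver` (§1–§2, plumbing along a base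
change `t : T′ → T`) and `….AbelianSchemeOver.DualPair` (§3–§4).  ONE `def` by `Exists.choose` over the ★ `∃!` (`weilUnit`), three plumbing `def`s
(`sectionAlong`, `alongTranslationAction`, `alongLineBundleIso` — the general-`t` forms of ★ `TorsionSectionPointDatum.sectionAt ∕ pointTranslationAction ∕
pointLineBundleIso`, which are typed for a geometric point `t`) + theorems; no named fact, no instance, no notation, no `sorry`.  Cell `hodgecm-mathlib`
(D-0151), FLOOR 0, P6 «MOD programme» (crux hLiu418 = stmt-HodgeConjecture-24832), W-line `Cruxes/HLiu418/Lines/F0_P6b_WeilCartierDuality.lean` letter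
`stub_W1` «WeilPairingNatural» (LEAD F0P6-plan (g2) M-17u∕M-17v, σ1 plan of record, organ (σ1-b); road memo
`F0/P6/B-p08/g32/ROAD-sigma1-WeilPairingNatural.v1.B-p08g32.md`): the CHARACTER FAMILY `χ_T(ŷ, x)` that the Cartier-side dock (σ1-a) (B-p04,
`CartierDualCharacterYoneda`) turns into the homomorphism `Â[n] → (A[n])^D`.  HC_CM is proved only modulo the printed citations until rung 0 closes; nothing
here is about HC.

THE PRINT.  [MumfordAV1970] §20 pp. 183–185: for `L ∈ Pic⁰(X)` of order `n`, `n_X^* L` is trivial and the translations by the points of `X_n` act on a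
trivialisation through a CHARACTER `e_n(·, L) : X_n → 𝔾_m`; «`e_n` is a pairing, compatible with base change».  Everything substantive is ★ and DEF-FREE:
★ `TorsionPairing.exists_poincarePairingUnit_fun` (the units as witnesses of the `∃!` ★ `existsUnique_pairingUnit`, for ANY action over `[n]_{A_T}`),
★ `pairingUnit_mul ∕ _one ∕ _pow_eq_one`, independence ★ `pairingUnit_eq_of_iso`, and base change ★ `TorsionSectionPairingBaseChange.pairingUnit_baseChange`
(VARIABLE intertwined actions).  THIS FILE names the function for the TRANSLATION action of the `n`-torsion sections of `A_T` (★ `translationActionMulN`)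
and instantiates the base change along an arbitrary `t : T′ → T`, which is the «naturality in the test ring» of the character family.

WHAT IS HERE (`𝒜/S` abelian with commutative law, `S` reduced locally Noetherian, `D = (Â, 𝒫)` with the unit hypothesis `hD`, `f : T → S`, `T` locally
Noetherian, `c : Over.mk f ⟶ D.hat.X` with `c ^ n = 1`):
* §1 along `t : T′ → T` (general `t`): `sectionAlong f t : (𝒜.baseChange f).Sections →* (𝒜.baseChange (t ≫ f)).Sections` (through ★ `baseChangeCompGrpIso`),
  `sectionAlong_comp_hom`, `torsionSectionAlong`, the action `alongTranslationAction n f t` of `(𝒜_T)[n](T)` on `𝒜_{T′}` over `[n]` and its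
  intertwining `alongTranslationAction_autHom_comp_baseChangeRestrict` with ★ `translationActionMulN` along ★ `baseChangeRestrict f t` (the `hι` of ★ W1c);
* §2 the Poincaré slice along `t`: `pointAlong t c : Over.mk (t ≫ f) ⟶ D.hat.X` (`= t ≫ c`), `pointAlong_pow`, `baseChangeRestrict_comp_baseChangeToProd'`,
  `alongLineBundleIso : L_{c ∘ t} ≅ q^* L_c` (the `j₁` of ★ W1c), `nonempty_pullback_baseChangeRestrict_unit_iso_unit` (the `j₀`);
* §3 **`weilUnit D hD n f c hc : (𝒜.baseChange f).torsionSections n → Γ(T, ⊤)`**, `weilUnit_spec` (its discrepancy equations for SOME trivialisation of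
  `[n]^* L_c`), **`eq_weilUnit`** (any solution of the equations, for ANY trivialisation, IS `weilUnit` — so the `def` is canonical), `weilUnit_mul`,
  `weilUnit_one`, `weilUnit_pow_eq_one`, `isUnit_weilUnit`;
* §4 **`weilUnit_baseChange`**: `e_n(x ×_T T′, ŷ ∘ t) = t^♯ e_n(x, ŷ)` — `weilUnit D hD n (t ≫ f) (pointAlong t c) _ ⟨sectionAlong f t x, _⟩ = t.appTop (weilUnit D hD n f c hc x)`.

NOT HERE (sequel organs of the σ1 road): multiplicativity in `ŷ` ((σ1-c), ★ (P-⊗)); non-degeneracy ((σ1-d), descent along `[n]`); naturality in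
homomorphisms `A → B` ((σ1-e)); the universal point and the iso `Â[q] ≅ (A[q])^D` ((σ1-a)+(σ1-f)).

## References
* [MumfordAV1970] D. Mumford, *Abelian Varieties* (1970), §20 (pp. 183–185), §15 Thm. 1 (p. 143), §7 Thm. 4 (p. 72).
* [MilneAV2008] J. S. Milne, *Abelian Varieties* (2008), I §11 (the `e_m`-pairing), I §8 (pp. 36–37).
* [GortzWedhorn2020] U. Görtz, T. Wedhorn, *Algebraic Geometry I*, 2nd ed. (2020), Section (4.7), (4.7.1) (p. 108).
-/

set_option autoImplicit false

noncomputable section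

-- `TopCat.Presheaf`/`Scheme.Modules` are not reducible (as in Mathlib's `AlgebraicGeometry/Modules` and ★ `TorsionSectionPairing*`).
set_option backward.isDefEq.respectTransparency false

universe u

open CategoryTheory CategoryTheory.Limits AlgebraicGeometry MonoidalCategory CartesianMonoidalCategory TopologicalSpace
  Opposite
open scoped MonObj

namespace Literature.AlgebraicGeometry.AbelianSchemes.AbelianSchemeOver

open Literature.AlgebraicGeometry.RelativeSpec Literature.AlgebraicGeometry.Modules Literature.AlgebraicGeometry.Motives
  Literature.AlgebraicGeometry.RelativeSpec.ActionOver

/-! ## §1 Sections and the translation action along a base change `t : T′ ⟶ T` -/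

section Along

open scoped CategoryTheory.Obj

variable {S : Scheme.{u}} (A : AbelianSchemeOver S) (M : ℕ) {T T' : Scheme.{u}} (f : T ⟶ S) (t : T' ⟶ T)

/-- **Sections of `A_T` pulled back along `t : T′ → T`, read as sections of `A_{t ≫ f} = A ×_S T′`** (through ★ `baseChangeCompGrpIso⁻¹ :
(A_T)_{T′} ≅ A_{t ≫ f}`), a group homomorphism; the general-`t` form of ★ `sectionAt`. [cite: GortzWedhorn2020, Section (4.7), (4.7.1) (p. 108)] -/
def sectionAlong : (A.baseChange f).Sections →* (A.baseChange (t ≫ f)).Sections where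
  toFun k := (A.baseChange f).sectionBaseChange t k ≫ (A.baseChangeCompGrpIso f t).inv.hom.hom
  map_one' := by rw [map_one, MonObj.one_comp]
  map_mul' k k' := by rw [map_mul, MonObj.mul_comp]

/-- Unfolding. [cite: GortzWedhorn2020, Section (4.7), (4.7.1) (p. 108)] -/
theorem sectionAlong_apply (k : (A.baseChange f).Sections) :
    A.sectionAlong f t k = (A.baseChange f).sectionBaseChange t k ≫ (A.baseChangeCompGrpIso f t).inv.hom.hom := rfl

/-- `sectionAlong k ≫ ψ = k ×_T T′` for `ψ : A_{t ≫ f} ≅ (A_T)_{T′}`. [cite: GortzWedhorn2020, Section (4.7), (4.7.1) (p. 108)] -/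
theorem sectionAlong_comp_hom (k : (A.baseChange f).Sections) :
    A.sectionAlong f t k ≫ (A.baseChangeCompGrpIso f t).hom.hom.hom = (A.baseChange f).sectionBaseChange t k := by
  ext : 1
  rw [Over.comp_left, sectionAlong_apply, Over.comp_left, Category.assoc, baseChangeCompGrpIso_inv_left_hom_left]
  exact Category.comp_id _

variable [IsCommMonObj (A.baseChange f).X]

/-- A torsion section stays torsion along `t`. [cite: MumfordFogartyKirwan1994, Ch. 7 §2 Definition 7.2 (p. 129)] -/
theorem sectionAlong_pow_eq_one (k : (A.baseChange f).torsionSections M) :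
    A.sectionAlong f t (k : (A.baseChange f).Sections) ^ M = 1 := by
  rw [← map_pow, (A.baseChange f).torsionSections_pow M k, map_one]

variable [IsCommMonObj (A.baseChange (t ≫ f)).X]

/-- The section along `t` as an `M`-torsion section of `A_{t ≫ f}`. [cite: MumfordFogartyKirwan1994, Ch. 7 §2 Definition 7.2 (p. 129)] -/
def torsionSectionAlong : (A.baseChange f).torsionSections M →* (A.baseChange (t ≫ f)).torsionSections M where
  toFun k := ⟨A.sectionAlong f t (k : (A.baseChange f).Sections), A.sectionAlong_pow_eq_one M f t k⟩
  map_one' := Subtype.ext (by simp only [OneMemClass.coe_one, map_one])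
  map_mul' k k' := Subtype.ext (by simp only [Subgroup.coe_mul, map_mul])

/-- Unfolding. [cite: MumfordFogartyKirwan1994, Ch. 7 §2 Definition 7.2 (p. 129)] -/
@[simp] theorem coe_torsionSectionAlong (k : (A.baseChange f).torsionSections M) :
    ((A.torsionSectionAlong M f t k : (A.baseChange (t ≫ f)).torsionSections M) : (A.baseChange (t ≫ f)).Sections) =
      A.sectionAlong f t (k : (A.baseChange f).Sections) := rfl

/-- **The translation action of `A_T[M](T)` on `A_{t ≫ f}` over `[M]`** (by the sections along `t`); the general-`t` form of ★ `pointTranslationAction`.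
[cite: MumfordAV1970, §20 (p. 184)] [cite: MumfordAV1970, §7 Thm. 4 (p. 72)] -/
def alongTranslationAction : ActionOver ((A.baseChange (t ≫ f)).mulN M).left ((A.baseChange f).torsionSections M) :=
  (A.baseChange (t ≫ f)).translationActionOfHom M ((A.sectionAlong f t).comp ((A.baseChange f).torsionSections M).subtype)
    fun k => by
      rw [MonoidHom.comp_apply, ← map_pow, Subgroup.subtype_apply, (A.baseChange f).torsionSections_pow M k, map_one]

/-- `k` acts on `A_{t ≫ f}` by the translation by `sectionAlong k` (unfolding). [cite: MumfordAV1970, §7 Thm. 4 (p. 72)] -/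
theorem alongTranslationAction_autHom (k : (A.baseChange f).torsionSections M) :
    (A.alongTranslationAction M f t).autHom k =
      ((A.baseChange (t ≫ f)).translation (A.sectionAlong f t (k : (A.baseChange f).Sections))).left := rfl

/-- The action along `t` IS the translation action of `A_{t ≫ f}[M](T′)` restricted along `torsionSectionAlong` (same automorphisms, definitionally).
[cite: MumfordAV1970, §7 Thm. 4 (p. 72)] -/
theorem alongTranslationAction_autHom_eq_translationActionMulN_autHom (k : (A.baseChange f).torsionSections M) :
    (A.alongTranslationAction M f t).autHom k =
      ((A.baseChange (t ≫ f)).translationActionMulN M).autHom (A.torsionSectionAlong M f t k) := rfl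

/-- **The actions are intertwined by `A_{t ≫ f} → A_T`**: `ρ′_k ≫ q = q ≫ ρ_k` — the hypothesis `hι` of ★ `pairingUnit_baseChange`; the general-`t`
form of ★ `pointTranslationAction_autHom_comp_baseChangeRestrict`. [cite: MumfordAV1970, §20 (p. 184)] [cite: GortzWedhorn2023, Def. 27.1 (p. 604)] -/
theorem alongTranslationAction_autHom_comp_baseChangeRestrict (k : (A.baseChange f).torsionSections M) :
    (A.alongTranslationAction M f t).autHom k ≫ A.baseChangeRestrict f t =
      A.baseChangeRestrict f t ≫ ((A.baseChange f).translationActionMulN M).autHom k := by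
  -- `q = ψ ≫ pr` (the general-`t` form of ★ `baseChangeRestrict_eq_comp`, which is typed for a geometric point)
  have hq : A.baseChangeRestrict f t = (A.baseChangeCompGrpIso f t).hom.hom.hom.left ≫ pullback.fst (A.baseChange f).X.hom t := by
    refine pullback.hom_ext ?_ ?_
    · rw [baseChangeRestrict_comp_fst, Category.assoc]
      exact (A.baseChangeCompGrpIso_hom_left_fst_fst f t).symm
    · rw [baseChangeRestrict_comp_snd, Category.assoc]
      change _ = _ ≫ pullback.fst (A.baseChange f).X.hom t ≫ (A.baseChange f).X.hom
      rw [pullback.condition]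
      change _ = _ ≫ pullback.snd (pullback.snd A.X.hom f) t ≫ t
      rw [A.baseChangeCompGrpIso_hom_left_snd_assoc f t]
  rw [alongTranslationAction_autHom, translationActionMulN_autHom, hq, ← Category.assoc, ← Over.comp_left,
    translation_comp_hom, sectionAlong_comp_hom, Over.comp_left, Category.assoc, Category.assoc,
    (A.baseChange f).translation_sectionBaseChange t, baseChangeHom_left_comp_fst]

end Along

/-! ## §2 The Poincaré slice along `t`: `L_{c ∘ t} ≅ q^* L_c` -/

section Slice

variable {S : Scheme.{u}} (A : AbelianSchemeOver S) {T T' : Scheme.{u}} (f : T ⟶ S) (t : T' ⟶ T)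

/-- **A `T`-point along `t`**: `c ↦ t ≫ c` as a `T′`-point over `t ≫ f` (pre-composition with `Over.homMk t : Over.mk (t ≫ f) ⟶ Over.mk f`).
[cite: GortzWedhorn2020, Section (4.7), (4.7.1) (p. 108)] -/
abbrev pointAlong {B : Over S} (c : Over.mk f ⟶ B) : Over.mk (t ≫ f) ⟶ B :=
  (Over.homMk t rfl : Over.mk (t ≫ f) ⟶ Over.mk f) ≫ c

/-- Underlying morphism of the point along `t`. [cite: GortzWedhorn2020, Section (4.7), (4.7.1) (p. 108)] -/
theorem pointAlong_left {B : Over S} (c : Over.mk f ⟶ B) : (pointAlong f t c).left = t ≫ c.left := rfl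

/-- Points along `t` of a group object: `(t ≫ c) ^ M = t ≫ c ^ M`; in particular torsion points stay torsion. [cite: MumfordAV1970, §20 (p. 184)] -/
theorem pointAlong_pow {B : Over S} [GrpObj B] (c : Over.mk f ⟶ B) (M : ℕ) : pointAlong f t c ^ M = pointAlong f t (c ^ M) :=
  (MonObj.comp_pow _ _ _).symm

/-- `c ^ M = 1 ⇒ (t ≫ c) ^ M = 1`. [cite: MumfordAV1970, §20 (p. 184)] -/
theorem pointAlong_pow_eq_one {B : Over S} [GrpObj B] (c : Over.mk f ⟶ B) {M : ℕ} (hc : c ^ M = 1) : pointAlong f t c ^ M = 1 := by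
  rw [pointAlong_pow, hc]
  exact MonObj.comp_one _

variable (D : A.DualPair)

/-- **`q ≫ (1_A × c) = 1_A × (t ≫ c)`** as maps `A_{t ≫ f} → A ×_S Â` (`q : A_{t ≫ f} → A_T` the base-change square ★ `baseChangeRestrict`); the
general-`t` form of ★ `baseChangeRestrict_comp_baseChangeToProd`. [cite: MilneAV2008, I §8 pp. 36–37] -/
theorem baseChangeRestrict_comp_baseChangeToProd' (c : Over.mk f ⟶ D.hat.X) :
    A.baseChangeRestrict f t ≫ A.baseChangeToProd D.hat f c.left (Over.w c) =
      A.baseChangeToProd D.hat (t ≫ f) (pointAlong f t c).left (Over.w (pointAlong f t c)) := by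
  refine pullback.hom_ext ?_ ?_
  · rw [Category.assoc, baseChangeToProd_fst, baseChangeRestrict_comp_fst, baseChangeToProd_fst]
  · rw [Category.assoc, baseChangeToProd_snd, baseChangeRestrict_comp_snd_assoc, baseChangeToProd_snd, pointAlong_left]

/-- **`L_{t ≫ c} ≅ q^* L_c`**: the slice `(1 × (t ≫ c))^*𝒫` on `A_{t ≫ f}` IS the restriction along `q : A_{t ≫ f} → A_T` of the slice `L_c = (1 × c)^*𝒫` on
`A_T` — the `j₁` of ★ `pairingUnit_baseChange`; the general-`t` form of ★ `pointLineBundleIso`. [cite: MilneAV2008, I §8 pp. 36–37]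
[cite: MumfordFogartyKirwan1994, Ch. 6 §2 Definition 6.2 (p. 120)] -/
def alongLineBundleIso (c : Over.mk f ⟶ D.hat.X) :
    D.pullbackP (t ≫ f) (pointAlong f t c).left (Over.w (pointAlong f t c)) ≅
      (Scheme.Modules.pullback (A.baseChangeRestrict f t)).obj (D.pullbackP f c.left (Over.w c)) :=
  ((Scheme.Modules.pullbackCongr (A.baseChangeRestrict_comp_baseChangeToProd' f t D c)).app D.P).symm ≪≫
    ((Scheme.Modules.pullbackComp (A.baseChangeRestrict f t) (A.baseChangeToProd D.hat f c.left (Over.w c))).app D.P).symm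

/-- **`q^* 𝒪_{A_T} ≅ 𝒪_{A_{t ≫ f}}`** — the `j₀` of ★ `pairingUnit_baseChange` (the functor `U ↦ q⁻¹U` on opens is final; the pattern of ★
`TorsionPairing.nonempty_pullback_mulN_unit_iso_unit`). [cite: Hartshorne1977, II §5 p. 110 (f^*𝒪_Y = 𝒪_X)] -/
theorem nonempty_pullback_baseChangeRestrict_unit_iso_unit :
    Nonempty ((Scheme.Modules.pullback (A.baseChangeRestrict f t)).obj (SheafOfModules.unit (A.baseChange f).X.left.ringCatSheaf) ≅
      SheafOfModules.unit (A.baseChange (t ≫ f)).X.left.ringCatSheaf) := by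
  have hI : IsIso (SheafOfModules.pullbackObjUnitToUnit (A.baseChangeRestrict f t).toRingCatSheafHom) := by
    haveI := Literature.AlgebraicGeometry.KTheory.final_opensMap (A.baseChangeRestrict f t)
    exact SheafOfModules.instIsIsoPullbackObjUnitToUnitOfFinal _
  exact ⟨@asIso _ _ _ _ (SheafOfModules.pullbackObjUnitToUnit (A.baseChangeRestrict f t).toRingCatSheafHom) hI⟩

end Slice

/-! ## §3 The Weil unit of an `n`-torsion section against an `n`-torsion point of the dual -/

namespace DualPair

open TorsionPairing

variable {S : Scheme.{u}} {A : AbelianSchemeOver S} [IsReduced S] [IsLocallyNoetherian S] (D : A.DualPair)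
  (hD : Nonempty ((Scheme.Modules.pullback (DualPair.unitHatSlice D)).obj D.P ≅ SheafOfModules.unit _)) (n : ℕ)
  {T : Scheme.{u}} (f : T ⟶ S) [IsLocallyNoetherian T] [IsCommMonObj (A.baseChange f).X] (c : Over.mk f ⟶ D.hat.X) (hc : c ^ n = 1)

include hD hc in
/-- The ★ existence statement, instantiated at the translation action of the `n`-torsion sections of `A_T` (★ `translationActionMulN`).
[cite: MumfordAV1970, §20 (p. 184)] -/
theorem exists_weilUnit :
    ∃ (e : (Scheme.Modules.pullback ((A.baseChange f).mulN n).left).obj (D.pullbackP f c.left (Over.w c)) ≅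
        (Scheme.Modules.pullback ((A.baseChange f).mulN n).left).obj (SheafOfModules.unit (A.baseChange f).X.left.ringCatSheaf))
      (u : (A.baseChange f).torsionSections n → Γ(T, ⊤)), ∀ g : (A.baseChange f).torsionSections n,
        (Scheme.Modules.pullback (((A.baseChange f).translationActionMulN n).autHom g)).map e.hom ≫
          ((EquivariantStructure.ofPullback ((A.baseChange f).translationActionMulN n)
            (SheafOfModules.unit (A.baseChange f).X.left.ringCatSheaf)).iso g).hom =
        ((EquivariantStructure.ofPullback ((A.baseChange f).translationActionMulN n) (D.pullbackP f c.left (Over.w c))).iso g).hom ≫ e.hom ≫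
          globalScalar _ (((A.baseChange f).mulN n).left.appTop ((A.baseChange f).X.hom.appTop (u g))) :=
  exists_poincarePairingUnit_fun D f hD c hc ((A.baseChange f).translationActionMulN n)

/-- **THE WEIL UNIT `e_n(x, ŷ) ∈ Γ(T, 𝒪_T)`** of an `n`-torsion section `x` of `A_T` against an `n`-torsion `T`-point `ŷ = c` of `Â`: the pairing unit of the
translation `t_x` acting (over `[n]_{A_T}`) on a trivialisation of `[n]^* L_c`, `L_c = (1 × c)^*𝒫` — [MumfordAV1970] §20 p. 184's `e_n(x, L)`.  A `def` by
choice over ★ `exists_poincarePairingUnit_fun`; CANONICAL by `eq_weilUnit` (any trivialisation, any solution of the equations gives this value).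
[cite: MumfordAV1970, §20 (p. 184)] [cite: MilneAV2008, I §11] -/
def weilUnit : (A.baseChange f).torsionSections n → Γ(T, ⊤) :=
  (D.exists_weilUnit hD n f c hc).choose_spec.choose

/-- The defining discrepancy equations of `weilUnit`, for SOME trivialisation of `[n]^* L_c`. [cite: MumfordAV1970, §20 (p. 184)] -/
theorem weilUnit_spec :
    ∃ e : (Scheme.Modules.pullback ((A.baseChange f).mulN n).left).obj (D.pullbackP f c.left (Over.w c)) ≅
        (Scheme.Modules.pullback ((A.baseChange f).mulN n).left).obj (SheafOfModules.unit (A.baseChange f).X.left.ringCatSheaf),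
      ∀ g : (A.baseChange f).torsionSections n,
        (Scheme.Modules.pullback (((A.baseChange f).translationActionMulN n).autHom g)).map e.hom ≫
          ((EquivariantStructure.ofPullback ((A.baseChange f).translationActionMulN n)
            (SheafOfModules.unit (A.baseChange f).X.left.ringCatSheaf)).iso g).hom =
        ((EquivariantStructure.ofPullback ((A.baseChange f).translationActionMulN n) (D.pullbackP f c.left (Over.w c))).iso g).hom ≫ e.hom ≫
          globalScalar _ (((A.baseChange f).mulN n).left.appTop ((A.baseChange f).X.hom.appTop (D.weilUnit hD n f c hc g))) :=
  ⟨_, (D.exists_weilUnit hD n f c hc).choose_spec.choose_spec⟩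

/-- **`weilUnit` IS CANONICAL**: for ANY trivialisation `e′` of `[n]^* L_c` and any `g`, a scalar `c′ ∈ Γ(T, 𝒪_T)` satisfying the discrepancy equation
of `e′` at `g` equals `weilUnit … g` (★ `pairingUnit_eq_of_iso`: independence of the trivialisation, and uniqueness ★ `existsUnique_pairingUnit`).
[cite: MumfordAV1970, §20 (p. 184)] -/
theorem eq_weilUnit
    (e' : (Scheme.Modules.pullback ((A.baseChange f).mulN n).left).obj (D.pullbackP f c.left (Over.w c)) ≅
      (Scheme.Modules.pullback ((A.baseChange f).mulN n).left).obj (SheafOfModules.unit (A.baseChange f).X.left.ringCatSheaf))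
    (g : (A.baseChange f).torsionSections n) (c' : Γ(T, ⊤))
    (hc' : (Scheme.Modules.pullback (((A.baseChange f).translationActionMulN n).autHom g)).map e'.hom ≫
          ((EquivariantStructure.ofPullback ((A.baseChange f).translationActionMulN n)
            (SheafOfModules.unit (A.baseChange f).X.left.ringCatSheaf)).iso g).hom =
        ((EquivariantStructure.ofPullback ((A.baseChange f).translationActionMulN n) (D.pullbackP f c.left (Over.w c))).iso g).hom ≫ e'.hom ≫
          globalScalar _ (((A.baseChange f).mulN n).left.appTop ((A.baseChange f).X.hom.appTop c'))) :
    c' = D.weilUnit hD n f c hc g := by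
  obtain ⟨e, he⟩ := D.weilUnit_spec hD n f c hc
  exact pairingUnit_eq_of_iso (A.baseChange f) _ _ e' e g c' _ hc' (he g)

/-- **`e_n(x x′, ŷ) = e_n(x, ŷ) · e_n(x′, ŷ)`** — multiplicativity in the torsion section (★ `pairingUnit_mul`). [cite: MumfordAV1970, §20 (p. 184)] -/
theorem weilUnit_mul (g h : (A.baseChange f).torsionSections n) :
    D.weilUnit hD n f c hc (g * h) = D.weilUnit hD n f c hc g * D.weilUnit hD n f c hc h := by
  obtain ⟨e, he⟩ := D.weilUnit_spec hD n f c hc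
  exact pairingUnit_mul (A.baseChange f) _ _ e _ he g h

/-- **`e_n(1, ŷ) = 1`** (★ `pairingUnit_one`). [cite: MumfordAV1970, §20 (p. 184)] -/
theorem weilUnit_one : D.weilUnit hD n f c hc 1 = 1 := by
  obtain ⟨e, he⟩ := D.weilUnit_spec hD n f c hc
  exact pairingUnit_one (A.baseChange f) _ _ e _ he

/-- **`e_n(x, ŷ)^n = 1`** — the Weil unit is an `n`-th root of unity in `Γ(T, 𝒪_T)` (★ `pairingUnit_pow_eq_one`, `x ^ n = 1`). [cite: MumfordAV1970, §20 (p. 184)] -/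
theorem weilUnit_pow_eq_one (g : (A.baseChange f).torsionSections n) : D.weilUnit hD n f c hc g ^ n = 1 := by
  obtain ⟨e, he⟩ := D.weilUnit_spec hD n f c hc
  have hg : g ^ n = 1 := Subtype.ext (by rw [Subgroup.coe_pow, Subgroup.coe_one]; exact (A.baseChange f).torsionSections_pow n g)
  exact pairingUnit_pow_eq_one (A.baseChange f) _ _ e _ he hg

/-- The Weil unit is a unit of `Γ(T, 𝒪_T)` for `n ≠ 0`. [cite: MumfordAV1970, §20 (p. 184)] -/
theorem isUnit_weilUnit (hn : n ≠ 0) (g : (A.baseChange f).torsionSections n) : IsUnit (D.weilUnit hD n f c hc g) :=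
  IsUnit.of_pow_eq_one (D.weilUnit_pow_eq_one hD n f c hc g) hn

/-- `e_n(x⁻¹, ŷ) = e_n(x, ŷ)⁻¹` in the form `e_n(x⁻¹, ŷ) · e_n(x, ŷ) = 1`. [cite: MumfordAV1970, §20 (p. 184)] -/
theorem weilUnit_inv_mul (g : (A.baseChange f).torsionSections n) : D.weilUnit hD n f c hc g⁻¹ * D.weilUnit hD n f c hc g = 1 := by
  rw [← weilUnit_mul, inv_mul_cancel, weilUnit_one]

/-! ## §4 Base change of the Weil unit along `t : T′ ⟶ T` -/

/-- **THE WEIL UNIT COMMUTES WITH BASE CHANGE: `e_n(x ×_T T′, ŷ ∘ t) = t^♯ e_n(x, ŷ)`** — for `t : T′ → T` (`T′` locally Noetherian), the Weil unit over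
`T′` of the section `x` along `t` against the point `t ≫ c` is the pull-back of the Weil unit over `T`: ★ `pairingUnit_baseChange` along the square
`q : A_{t ≫ f} → A_T` (★ `baseChangeRestrict`: over `t`, commuting with `[n]`, intertwining the translation actions §1), with `j₁ := alongLineBundleIso`,
`j₀ : q^*𝒪 ≅ 𝒪` (§2), and the canonicity of `weilUnit` over `T′` (§3; the action along `t` has the same automorphisms as the translation action of
`A_{t ≫ f}[n](T′)` at the sections along `t`, definitionally).  This is the naturality in the test scheme of the character family `(ŷ, x) ↦ e_n(x, ŷ)`.
[cite: MumfordAV1970, §20 (pp. 184–185)] [cite: GortzWedhorn2020, Section (4.7), (4.7.1) (p. 108)] -/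
theorem weilUnit_baseChange {T' : Scheme.{u}} (t : T' ⟶ T) [IsLocallyNoetherian T'] [IsCommMonObj (A.baseChange (t ≫ f)).X]
    (g : (A.baseChange f).torsionSections n) :
    D.weilUnit hD n (t ≫ f) (pointAlong f t c) (pointAlong_pow_eq_one f t c hc) (A.torsionSectionAlong n f t g) =
      t.appTop (D.weilUnit hD n f c hc g) := by
  obtain ⟨e, he⟩ := D.weilUnit_spec hD n f c hc
  obtain ⟨e'', he''⟩ := D.weilUnit_spec hD n (t ≫ f) (pointAlong f t c) (pointAlong_pow_eq_one f t c hc)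
  obtain ⟨j₀⟩ := A.nonempty_pullback_baseChangeRestrict_unit_iso_unit f t
  exact pairingUnit_baseChange t (A.baseChangeRestrict f t) (A.baseChangeRestrict_comp_hom f t) (A.baseChangeRestrict_comp_mulN_left n f t)
    ((A.baseChange f).translationActionMulN n) (A.alongTranslationAction n f t) (A.alongTranslationAction_autHom_comp_baseChangeRestrict n f t)
    (D.pullbackP f c.left (Over.w c)) (hasRank_pullbackP D f c) e
    (D.pullbackP (t ≫ f) (pointAlong f t c).left (Over.w (pointAlong f t c))) (A.alongLineBundleIso f t D c) j₀
    (D.weilUnit hD n f c hc) he e'' g _ (he'' (A.torsionSectionAlong n f t g))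

end DualPair

end Literature.AlgebraicGeometry.AbelianSchemes.AbelianSchemeOver

end
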